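/-
Copyright: statement-level skeleton of a published paper (lit-balaban cell, Phase-2 proof seat p25, gen 17). No proof
claims beyond what the kernel checks below.
-/
import Literature.MathematicalPhysics.QuantumFieldTheory.BalabanImbrieJaffe1984to88.BIJ88LabelledDiamDecay312

/-!
# `BalabanImbrieJaffe1984to88.BIJ88LabelledBlockDecay312` — T. Bałaban, J. Imbrie, A. Jaffe, *Effective action and cluster
properties of the abelian Higgs model*, Commun. Math. Phys. **114** (1988) 257–315 [BalabanImbrieJaffe1988], §5.14
p. 312 [PDF 56]: *"Summing all possible diagrams in X_c gives the observable for the next step there, F^L_{k+1,loc}(X_c)."* —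
**THE CONSTANT BLOCK OF A SET OF OBSERVABLES DECAYS IN THE DIAMETER OF THEIR CUBES.**  `fl i B` of
`BIJ88Resummation312` is the sum of the weights of the constant outcomes of the run of the observable `i` that absorb
exactly the observables `B` (the labelled model's `F^L_{k+1,loc}(X_c)` for `X_c ↔ {i} ∪ B`, up to the order in which `X_c`
is built); with the counting of `BIJ88LabelledTermCount312`/`BIJ88LabelledSumBounds312` (`|fl i B| ≤ (W·max B 1)^{rpot}`,
LARGE factors) and the located bookkeeping of `BIJ88LabelledDiamDecay312` (brackets `≤ B e^{−δ·dist}`, observables and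
vertices `r₀`-local) every such outcome has all its legs contracted, labels exactly `{i} ∪ B`, hence cubes = the cubes of
the observables `{i} ∪ B`, and its weight carries `e^{−δ·diam}` of that set:
`|fl i B| ≤ (W · max B 1 · max 1 (c_M e^{δ r₀}))^{rpot(pristine i, B, ∅)} · e^{δ r₀ (#B + 1)} · e^{−δ·diam(cubes of {i} ∪ B)}`
(`abs_fl_decay_le`) — the labelled currency's version of "F^L_{k+1,loc}(X_c) lives on X_c".

statement-level skeleton of published theorems with citation tags; proofs where landed; nothing here is a claim
about the Yang–Mills mass gap

PDF held: `paper:balaban1988-cmp114-bij-abelian-higgs-effective-action` (journal page = PDF page + 256); p. 312 = PDF 56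
(`p0056.txt` L3–4 re-read this session; the quoted sentence is verbatim there up to the OCR of sub/superscripts).

CITATION HEADER (lean-in-tree rule).  lit-balaban cell (HOME `run/shared/lean/pub/lit-balaban/`), Phase 2, seat p25
gen 17; row **C2.Claim@312** of `HOME/lit-balaban-r16/ROWS-C2-part2.md` (owner r16, referee ref-5; head
`BIJ88Sect5StatementsPart4.Ineq312` NOT touched — a MEMBER).  USED BY NAME, nothing restated: `BIJ88Resummation312.fl`,
`BIJ88LabelledRun311` (`run`, `rpot`, `pristine`), `BIJ88LabelledRunEnv311` (`run_const`, `run_lab`),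
`BIJ88LabelledTermCount312.run_wcount_le`, `BIJ88ComponentCubes311` (`cubes`, `diam_cubes_pristine`),
`BIJ88LabelledDiamDecay312` (`run_decay_bound`, `run_rpot_dv_le`).

## What is proved (0 `sorry`, standard axioms, no definitions, no `Prop` facts)

* `cubes_eq_of_const` (a constant outcome of the run of `i` in `B` with nothing left has cubes = the cubes of the
  observables `{i} ∪ B`), **`abs_fl_decay_le`** (displayed above).
HONEST SCOPE: as in `BIJ88LabelledDiamDecay312` — one covariance, decaying not finite-range: DIAMETER decay, not
connectedness / tree / volume decay; `W`-counting crude (factorial-like in `#B`); `r₀`, `B`, `δ` free.  CURRENCY: feeds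
none of `BIJ88Sect5StatementsPart4.Ineq312` / `hobs` / `RemainderComponent` by name, instantiates none of `Ineq312`'s
binders.  NOT summit progress; NOT continuum; NOT Clay.  Imports `BIJ88LabelledDiamDecay312` only; modifies nothing.
-/

noncomputable section

namespace Literature.MathematicalPhysics.QuantumFieldTheory.BalabanImbrieJaffe1984to88.BIJ88LabelledBlockDecay312

open Classical Matrix Finset
open scoped BigOperators
open BIJ88VertexComponents311 (Grp maxArity)
open BIJ88LabelledRun311 BIJ88LabelledRunEnv311 BIJ88LabelledExpansion311
open BIJ88Resummation312 (fl)
open BIJ88LabelledCoefBound312 BIJ88LabelledTermCount312 BIJ88ComponentCubes311 BIJ88LabelledDiamDecay312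

variable {S : Type} [Fintype S] [DecidableEq S] {ι : Type} [Fintype ι] {κ : Type} [LinearOrder κ]
variable {β : Type} [PseudoMetricSpace β]
variable {A : Matrix S S ℝ} {f : S → ℝ} {c : ι → ℝ} {legs : ι → List (S → ℝ)} {obs : κ → List (S → ℝ)} {M : ℕ}
  {Dir : Set (S → ℝ)} {loc : (S → ℝ) → β} {B cM δ r₀ : ℝ}

omit [Fintype S] [DecidableEq S] [Fintype ι] [LinearOrder κ] [PseudoMetricSpace β] in
/-- A sum over a multiset of terms each bounded by `b` is at most `#terms · b` (bookkeeping). [folklore] -/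
private theorem abs_sum_map_le_card_mul {X : Type} (s : Multiset X) (v : X → ℝ) {b : ℝ} (hb : ∀ x ∈ s, |v x| ≤ b) :
    |(s.map v).sum| ≤ Multiset.card s * b := by
  refine (Multiset.abs_sum_le_sum_abs).trans ?_
  rw [Multiset.map_map]
  refine (Multiset.sum_map_le_sum_map _ (fun _ => b) fun x hx => hb x hx).trans (le_of_eq ?_)
  rw [Multiset.map_const', Multiset.sum_replicate, nsmul_eq_mul]

omit [PseudoMetricSpace β] in
/-- **A constant block's cubes are the cubes of its observables**: a constant outcome of the run of `i` in the
environment `B` (nothing set aside) which leaves no observable untouched has no pending leg and labels exactly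
`{i} ∪ B` (`run_lab`, `run_const`), so its cubes are `loc '' {w | ∃ j ∈ {i} ∪ B, w ∈ obs j}`.
[cite: BalabanImbrieJaffe1988, §5.14 p.311–312] -/
theorem cubes_eq_of_const (i : κ) (Bs : Finset κ) :
    ∀ o ∈ run A f c legs obs M (pristine obs i) Bs 0, o.g.IsConst M → o.rest = ∅ →
      cubes loc obs o.g = cubes loc obs (⟨⟨[], 0, 0⟩, insert i Bs⟩ : LGrp S κ) := by
  intro o ho hconst hrest
  have hlab := run_lab (A := A) (f := f) (c := c) (legs := legs) (obs := obs) (M := M) _ _ _ o ho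
  have hdone : o.done = 0 := (run_const _ _ _ o ho (fun h hh => absurd hh (Multiset.notMem_zero _)) hconst).2
  rw [hdone, hrest, Multiset.map_zero, Multiset.sup_zero, Finset.bot_eq_empty, Finset.union_empty,
    Finset.union_empty, Finset.union_empty] at hlab
  -- hlab : o.g.lab = (pristine obs i).lab ∪ Bs
  have hl : o.g.lab = insert i Bs := by rw [hlab, Finset.insert_eq]; rfl
  have hp : o.g.pend = [] := hconst.1
  unfold cubes
  rw [hp, hl]

/-- **THE CONSTANT BLOCK `fl i B` DECAYS IN THE DIAMETER OF THE CUBES OF `{i} ∪ B`** (p. 312 *"Summing all possible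
diagrams in X_c gives … F^L_{k+1,loc}(X_c)"*, located): under the hypotheses of `BIJ88LabelledDiamDecay312.run_decay_bound`
(`δ, r₀ ≥ 0`, brackets `≤ B e^{−δ dist}` on `Dir ⊇` all legs, `|⟨A⁻¹u, ℱ⟩| ≤ B`, `|c_m| ≤ c_M`, `r₀`-local observables
and vertices) and `W ≥ rpot(pristine i, B, ∅) + Σ_m|legs m|`:
`|fl i B| ≤ (W · max B 1 · max 1 (c_M e^{δr₀}))^{rpot(pristine i, B, ∅)} · e^{δ r₀ (#B + 1)} · e^{−δ · diam(cubes of {i} ∪ B)}`.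
[cite: BalabanImbrieJaffe1988, §5.14 p.312] -/
theorem abs_fl_decay_le (hδ : 0 ≤ δ) (hr : 0 ≤ r₀)
    (hBd : ∀ u ∈ Dir, ∀ v ∈ Dir, |(A⁻¹ *ᵥ u) ⬝ᵥ v| ≤ B * Real.exp (-(δ * dist (loc u) (loc v))))
    (hBf : ∀ u ∈ Dir, |(A⁻¹ *ᵥ u) ⬝ᵥ f| ≤ B) (hcM : 0 ≤ cM) (hcm : ∀ m, |c m| ≤ cM)
    (hobs : ∀ j, ∀ w ∈ obs j, w ∈ Dir) (hlegs : ∀ m, ∀ w ∈ legs m, w ∈ Dir)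
    (hro : ∀ j, ∀ w ∈ obs j, ∀ w' ∈ obs j, dist (loc w) (loc w') ≤ r₀)
    (hrv : ∀ m, ∀ w ∈ legs m, ∀ w' ∈ legs m, dist (loc w) (loc w') ≤ r₀) (i : κ) (Bs : Finset κ) {W : ℕ}
    (hW : rpot obs M (maxArity legs) (pristine obs i) Bs 0 + ∑ m, (legs m).length ≤ W) :
    |fl A f c legs obs M i Bs|
      ≤ ((W : ℝ) * max B 1 * max 1 (cM * Real.exp (δ * r₀))) ^ rpot obs M (maxArity legs) (pristine obs i) Bs 0
        * Real.exp (δ * (r₀ * (Bs.card + 1)))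
        * Real.exp (-(δ * Metric.diam (cubes loc obs (⟨⟨[], 0, 0⟩, insert i Bs⟩ : LGrp S κ)))) := by
  have hm : 1 ≤ max B 1 := le_max_right B 1
  have hm0 : 0 ≤ max B 1 := zero_le_one.trans hm
  have hθ : 0 ≤ cM * Real.exp (δ * r₀) := mul_nonneg hcM (Real.exp_pos _).le
  have hΘ : 1 ≤ max 1 (cM * Real.exp (δ * r₀)) := le_max_left _ _
  unfold fl
  -- abbreviations (written out): R = rpot(pristine i, Bs, 0); D0 = diam of the cubes of {i} ∪ Bs
  -- the bound of one outcome
  have hterm : ∀ o ∈ (run A f c legs obs M (pristine obs i) Bs 0).filter (fun o => o.g.IsConst M ∧ o.rest = ∅),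
      |o.a| ≤ (max B 1 * max 1 (cM * Real.exp (δ * r₀))) ^ rpot obs M (maxArity legs) (pristine obs i) Bs 0
        * Real.exp (δ * (r₀ * (Bs.card + 1)))
        * Real.exp (-(δ * Metric.diam (cubes loc obs (⟨⟨[], 0, 0⟩, insert i Bs⟩ : LGrp S κ)))) := by
    intro o ho
    obtain ⟨ho', hconst, hrest⟩ := Multiset.mem_filter.1 ho
    have hrun := run_decay_bound hδ hr hBd hBf hcM hcm hobs hlegs hro hrv _ _ _ o ho' (hobs i)
      (fun h hh => absurd hh (Multiset.notMem_zero _))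
    have hdv := run_rpot_dv_le (A := A) (f := f) (c := c) (legs := legs) (obs := obs) (M := M) _ _ _ o ho'
    have hdone : o.done = 0 := (run_const _ _ _ o ho' (fun h hh => absurd hh (Multiset.notMem_zero _)) hconst).2
    have hcub := cubes_eq_of_const (A := A) (f := f) (c := c) (legs := legs) (obs := obs) (M := M) (loc := loc) i Bs
      o ho' hconst hrest
    have hD0 := diam_cubes_pristine loc obs hr hro i
    rw [hdone, hrest, hcub, Multiset.map_zero, Multiset.sum_zero, add_zero, add_zero, Finset.card_empty, Nat.cast_zero,
      mul_zero, add_zero] at hrun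
    -- hrun : |a| m^{Re} e^{δ D0} ≤ m^{R} (e^{δ (diam pristine + r₀ #Bs)} θ^{dv})
    have h1 : (1 : ℝ) ≤ (max B 1) ^ rpot obs M (maxArity legs) o.g ∅ 0 := one_le_pow₀ hm
    have hθpow : (cM * Real.exp (δ * r₀)) ^ o.dv
        ≤ (max 1 (cM * Real.exp (δ * r₀))) ^ rpot obs M (maxArity legs) (pristine obs i) Bs 0 :=
      (pow_le_pow_left₀ hθ (le_max_right _ _) _).trans (pow_le_pow_right₀ hΘ (by omega))
    have hexp : Real.exp (δ * (Metric.diam (cubes loc obs (pristine obs i)) + r₀ * Bs.card))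
        ≤ Real.exp (δ * (r₀ * (Bs.card + 1))) := Real.exp_le_exp.2 (by nlinarith)
    have hE : 0 < Real.exp (δ * Metric.diam (cubes loc obs (⟨⟨[], 0, 0⟩, insert i Bs⟩ : LGrp S κ))) := Real.exp_pos _
    -- |a| e^{δ D0} ≤ m^R e^{..} Θ^R
    have h2 : |o.a| * Real.exp (δ * Metric.diam (cubes loc obs (⟨⟨[], 0, 0⟩, insert i Bs⟩ : LGrp S κ)))
        ≤ (max B 1) ^ rpot obs M (maxArity legs) (pristine obs i) Bs 0
          * (Real.exp (δ * (r₀ * (Bs.card + 1))) * (max 1 (cM * Real.exp (δ * r₀))) ^ rpot obs M (maxArity legs)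
            (pristine obs i) Bs 0) := by
      calc |o.a| * Real.exp (δ * Metric.diam (cubes loc obs (⟨⟨[], 0, 0⟩, insert i Bs⟩ : LGrp S κ)))
          ≤ |o.a| * (max B 1) ^ rpot obs M (maxArity legs) o.g ∅ 0
            * Real.exp (δ * Metric.diam (cubes loc obs (⟨⟨[], 0, 0⟩, insert i Bs⟩ : LGrp S κ))) := by
            rw [mul_assoc]
            exact mul_le_mul_of_nonneg_left (le_mul_of_one_le_left hE.le h1) (abs_nonneg _)
        _ ≤ _ := hrun
        _ ≤ _ := mul_le_mul_of_nonneg_left (mul_le_mul hexp hθpow (pow_nonneg hθ _) (Real.exp_pos _).le)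
            (pow_nonneg hm0 _)
    rw [Real.exp_neg]
    refine (le_mul_inv_iff₀ hE).2 (h2.trans (le_of_eq ?_))
    rw [mul_pow]; ring
  refine (abs_sum_map_le_card_mul _ _ hterm).trans ?_
  -- the number of outcomes
  have hR1 : 1 ≤ rpot obs M (maxArity legs) (pristine obs i) Bs 0 := by simp only [rpot]; omega
  have hW0 : 0 < W := by omega
  have hcount : (Multiset.card ((run A f c legs obs M (pristine obs i) Bs 0).filter
      (fun o => o.g.IsConst M ∧ o.rest = ∅)) : ℝ) ≤ (W : ℝ) ^ rpot obs M (maxArity legs) (pristine obs i) Bs 0 := by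
    have hc := Multiset.card_le_card (Multiset.filter_le (fun o => o.g.IsConst M ∧ o.rest = ∅)
      (run A f c legs obs M (pristine obs i) Bs 0))
    have h := run_wcount_le (A := A) (f := f) (c := c) _ (pristine obs i) Bs 0 (Nat.lt_succ_self _) W hW
    have h1 : Multiset.card (run A f c legs obs M (pristine obs i) Bs 0)
        ≤ ((run A f c legs obs M (pristine obs i) Bs 0).map
            fun o => W ^ rpot obs M (maxArity legs) o.g o.rest o.done).sum := by
      have := Multiset.card_nsmul_le_sum (s := (run A f c legs obs M (pristine obs i) Bs 0).map
        fun o => W ^ rpot obs M (maxArity legs) o.g o.rest o.done) (a := 1) (fun x hx => by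
          obtain ⟨o, -, rfl⟩ := Multiset.mem_map.1 hx
          exact Nat.one_le_pow _ _ hW0)
      rwa [Multiset.card_map, smul_eq_mul, mul_one] at this
    exact_mod_cast hc.trans (h1.trans h)
  have hrest : 0 ≤ (max B 1 * max 1 (cM * Real.exp (δ * r₀))) ^ rpot obs M (maxArity legs) (pristine obs i) Bs 0
      * Real.exp (δ * (r₀ * (Bs.card + 1)))
      * Real.exp (-(δ * Metric.diam (cubes loc obs (⟨⟨[], 0, 0⟩, insert i Bs⟩ : LGrp S κ)))) :=
    mul_nonneg (mul_nonneg (pow_nonneg (mul_nonneg hm0 (zero_le_one.trans hΘ)) _) (Real.exp_pos _).le)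
      (Real.exp_pos _).le
  refine (mul_le_mul_of_nonneg_right hcount hrest).trans (le_of_eq ?_)
  ring

end Literature.MathematicalPhysics.QuantumFieldTheory.BalabanImbrieJaffe1984to88.BIJ88LabelledBlockDecay312

end
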